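import Summits.BirchSwinnertonDyer.Rank1Residual.Additive.X4TamDefectLevelLoweringFromWilesIhara
import HarnessLib

/-!
# TAM-DEFECT₂(3) on the twist-good locus, census shape, modulo the announced Kim 2025 clause — multiplicity one AND Ihara's lemma BY NAME (cell `b2b-bsdres`, seat additive-p4, line V44; class N11 at `p = 3`)

HONEST FRAMING (verbatim, cell `b2b-bsdres`): the goal of the cell is to DELETE the COMBINATION-SHAPED
residual classes for ALL analytic-rank `≤ 1` curves over `ℚ` — "full BSD formula for every rank `≤ 1`
curve in class `C`" assembled STRICTLY from published theorems — so that the rank-`≤ 1` remainder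
becomes exactly the CONSTRUCTION-SHAPED classes, which are TYPED (missing-input Props), NOT attempted;
this is not "finishing BSD". This file: TOOL theorems, 0 defs, 0 facts, nothing booked; X4
CONSTRUCTION-SHAPED; CONDITIONAL on the ANNOUNCED Kim 2025 clause (`hK25s`, flag `Kim2025-preprint`,
displayed as an OPEN binder — never a theorem).

## What is proved

The `p ≥ 3` TOWER twins, in CENSUS SHAPE (`E = C • W₀^{(d)}`), of gen 25's
`X4.bsdp_of_wiles1995_ihara_quadraticTwist_of_{pos,neg}_of_five_le`: on a unit TAM-DEFECT₂ tower row
(`r_an = 0`, `ρ_{E,p^∞}` onto at every layer, conductor-level datum with the period transfer, `#Ш_an`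
a `p`-unit, `ord_p ∏c ≤ 2`) on the TWIST-GOOD locus, **`BSD(E,p)`** from
* the ANNOUNCED Kim 2025 Thm. 1.1 clause (OPEN binder `Kim2025.thm11_kimShaLength_of_integralPeriod_OPEN`),
  Cassels–Tate, GZK, modularity;
* `wiles1995_multiplicityOne` (DDT Thm. 4.26, BY NAME; LIVE at `p = 3`: its binder is `p ≠ 2`) + the
  repaired Eichler–Shimura dictionary TARGET `EichlerShimuraModPMultiplicityOne{,Minus}OfIrreducible`
  whose rider `ES-dict-p3-elliptic` now BINDS and is DISPLAYED: `p ≠ 3 ∨ 9 ∣ Mℓ ∨ ∃ q ∣ Mℓ prime,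
  q ≡ 2 (mod 3)` (per row at `p = 3`: a prime `q ≡ 2 (mod 3)` of the twist partner's level);
* `ribet1984_iharaLemma` (Ribet 1984 Thm. 4.1, BY NAME; any odd residue characteristic) + the LEVEL-`M`
  EIGEN DATUM `(μ, θ, Λ, χ)` of Ribet's level-lowered form (displayed; existence = node (T2′));
* per-row numerals as in the `p ≥ 5` ENDs (no Manin numeral: the tower chain reads the period
  transfer only).
At `p = 3` this is the twist-good part of the N11 TAM-DEFECT₂(3) block (census gen 23: 479 of the
1 888 open unit TAM₂ cells at `p = 3`, 463 with a split multiplicative Tamagawa-`3` prime); the proof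
is gen 23's census-shape derivation (twist identity on the symbols of `f₀`, `a_q(W₀) = (q/d) a_q(E)`
at the Kolyvagin primes, Pal's unit, the vanishing branch) run into the `_kim2025_OPEN` consumers.

## References

* C.-H. Kim, *A refined Tamagawa number conjecture …*, arXiv:2505.09121 (2025), Thm. 1.1 — ANNOUNCED, OPEN binder. [cite: Kim2025RefinedTNC, Thm. 1.1 ("BSD") (ANNOUNCED, OPEN binder)]
* H. Darmon, F. Diamond, R. Taylor, *Fermat's Last Theorem* (1995), Thm. 4.26, Lemma 4.28 (a), Lemma 4.30. [cite: DarmonDiamondTaylor1995, Thm. 4.26 (§4.5, p. 134) and Lemma 4.28 (a) (p. 135)]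
* K. A. Ribet, Proc. ICM 1983 (1984), Thm. 4.1; Invent. Math. 100 (1990), Thm. 1.1. [cite: Ribet1984ICM, Thm. 4.1] [cite: Ribet1990, Thm. 1.1 and Thm. 5.2 (b)]
* A. Pál, Canad. J. Math. 64 (2012), Thm. 3.2 with Prop. 2.5. [cite: Pal2012, Thm. 3.2 with Prop. 2.5]
* J. H. Silverman, *The Arithmetic of Elliptic Curves* (2009), Thm. X.4.14. [cite: SilvermanAEC2009, Thm. X.4.14]
-/

noncomputable section

open scoped MatrixGroups ModularForm NumberTheorySymbols NumberField

open CongruenceSubgroup Finset IsDedekindDomain Polynomial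

open Literature.NumberTheory.EllipticCurves Literature.NumberTheory.EllipticCurves.ModularForms
  Literature.NumberTheory.EllipticCurves.ModularForms.HidaCohomology

namespace Summit.BirchSwinnertonDyer.Rank1Residual.X4

open Complex WeierstrassCurve Literature.NumberTheory.EllipticCurves.Rank1Residual
  Literature.NumberTheory.EllipticCurves.Rank1Residual.Typed
  Summit.BirchSwinnertonDyer.Rank1Residual.Additive
  Summit.BirchSwinnertonDyer.Rank1Residual.LevelLowering
  Literature.NumberTheory.GaloisRepresentations Rat.HeightOneSpectrum

variable {k : Type*} [CommRing k] [Nontrivial k]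
  (W₀ W : WeierstrassCurve ℚ) [W₀.IsElliptic] [W₀.IsGloballyMinimal] [W.IsElliptic] [W.IsGloballyMinimal]
  (p : ℕ) [hp5 : Fact p.Prime] (ι : ZMod p →+* k)

/-- `a_q(W₀) ≡ (q/d)·a_q(E) (mod p)` at every Kolyvagin prime `q` of `E = C • W₀^{(d)}` (good for `E`,
coprime to `d`): the twist of Fourier coefficients at good primes (`(q/d)² = 1`). Extracted from gen
23's census-shape ENDs. [folklore] -/
theorem lFunction_eq_jacobiSym_mul_frobeniusTrace_of_isKolyvaginPrime
    {N : ℕ} [NeZero N] (D : ModularParametrizationData W N) (hN : W.conductorNorm ℤ = N)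
    {d : ℤ} [NeZero d.natAbs] (hd4 : d % 4 = 1) (hsq : Squarefree d) (C : VariableChange ℚ)
    (hC : C • W₀.quadraticTwist (d : ℚ) = W)
    (hgm : ∀ v : HeightOneSpectrum (𝓞 ℚ), ((Rat.HeightOneSpectrum.primesEquiv v : ℕ) : ℤ) ∣ d →
      W₀.HasGoodReductionAt v ∨ W₀.HasMultiplicativeReductionAt v)
    (hmN : d.natAbs ∣ W.conductorNorm ℤ) {q : ℕ} (hq : Kato.IsKolyvaginPrime W p 1 q) :
    ((W₀.LFunction q : ℤ) : ZMod p) =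
      ((J((q : ℤ) | d.natAbs) : ℤ) : ZMod p) * (W.frobeniusTrace q : ZMod p) := by
  have hfW : IsNewformOf W D.f := D.isNewformOf
  have hqN : ¬ q ∣ N := fun h ↦ hq.not_dvd_conductorNorm (by rw [hN]; exact h)
  have htr : (W.LFunction q : ℂ) = (W.frobeniusTrace q : ℂ) := by
    rw [← hfW.2 q, IsNewformOf.cuspCoeff_eq_frobeniusTrace_of_not_dvd hfW hq.prime hqN]
  have hd0 : d ≠ 0 := by rintro rfl; norm_num at hd4
  haveI : (W₀.quadraticTwist (d : ℚ)).IsElliptic := W₀.isElliptic_quadraticTwist (by exact_mod_cast hd0)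
  have hLW : W.LFunction q = (W₀.quadraticTwist (d : ℚ)).LFunction q := by
    rw [← hC, LFunction_smul]
  have htr' : W.frobeniusTrace q = J((q : ℤ) | d.natAbs) * W₀.LFunction q := by
    have h1 : W.LFunction q = W.frobeniusTrace q := by exact_mod_cast htr
    rw [← h1, hLW, lFunction_quadraticTwist_apply_of_good_or_mult W₀ hd4 hsq hgm q]
  have hqm : q.Coprime d.natAbs :=
    (Nat.Prime.coprime_iff_not_dvd hq.prime).mpr fun hdv ↦
      hq.not_dvd_conductorNorm ((hdv.trans hmN))
  have hJ : ((J((q : ℤ) | d.natAbs) : ℤ) : ZMod p) ^ 2 = 1 := by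
    rw [← jacobiHom_natCast p, jacobiHom_natCast_sq_eq_one p hqm]
  rw [htr']
  push_cast
  linear_combination -(((W₀.LFunction q : ℤ) : ZMod p)) * hJ

/-- **TAM-DEFECT₂ ON THE TWIST-GOOD LOCUS, census shape, even twists `d > 0`, `p ≥ 3` TOWER rows,
modulo the ANNOUNCED Kim 2025 clause — MULTIPLICITY ONE AND IHARA'S LEMMA BOTH BY NAME.** At `p = 3`
(N11): the rider `ES-dict-p3-elliptic` of the dictionary target is DISPLAYED (`hrid`). Inputs BY NAME:
`Kim2025.thm11_kimShaLength_of_integralPeriod_OPEN` (ANNOUNCED, OPEN binder), Cassels–Tate, GZK,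
modularity, `wiles1995_multiplicityOne`, `ribet1984_iharaLemma`; TARGETS: the repaired dictionary node,
the level-`M` eigen datum of Ribet's form (displayed); numerals. ⟹ **`BSD(E,p)`**. Nothing booked.
[claim: Kim2025RefinedTNC, status: under-review]
[cite: Kim2025RefinedTNC, Thm. 1.1 ("BSD") (ANNOUNCED, OPEN binder)]
[cite: DarmonDiamondTaylor1995, Thm. 4.26 (§4.5, p. 134) and Lemma 4.28 (a) (p. 135)]
[cite: Ribet1984ICM, Thm. 4.1] [cite: Ribet1990, Thm. 1.1 and Thm. 5.2 (b)]
[cite: Pal2012, Thm. 3.2 with Prop. 2.5] [cite: SilvermanAEC2009, Thm. X.4.14] -/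
theorem bsdp_of_wiles1995_ihara_quadraticTwist_of_pos_of_kim2025_OPEN
    (hW1 : wiles1995_multiplicityOne) (hI : ribet1984_iharaLemma)
    (hK25s : Kim2025.thm11_kimShaLength_of_integralPeriod_OPEN)
    (hCT : exists_casselsTate_pairing (K := ℚ))
    (hGZK : rank_eq_analyticRank_of_analyticRank_le_one) (hmod : hasEntireLFunction_rat)
    (hp3 : 3 ≤ p) (hr : W.analyticRank = 0)
    (htower : ∀ n : ℕ, W.HasSurjectiveModNGaloisRep (p ^ n : ℕ))
    {N : ℕ} [NeZero N] (D : ModularParametrizationData W N) (hN : W.conductorNorm ℤ = N)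
    (hper : ∃ u : ℚ, ‖(u : ℚ_[p])‖ = 1 ∧ W.realPeriodRat = u * plusPeriod D.f)
    {q' : ℚ} (hq' : shaAn W = (q' : ℂ)) (hv : padicValRat p q' = 0)
    (hc2 : padicValNat p W.tamagawaProduct ≤ 2)
    -- the geometric twist datum
    {d : ℤ} (hd4 : d % 4 = 1) (hsq : Squarefree d) (hd : 0 < d) (C : VariableChange ℚ)
    (hC : C • W₀.quadraticTwist (d : ℚ) = W)
    (hgm : ∀ v : HeightOneSpectrum (𝓞 ℚ), ((Rat.HeightOneSpectrum.primesEquiv v : ℕ) : ℤ) ∣ d →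
      W₀.HasGoodReductionAt v ∨ W₀.HasMultiplicativeReductionAt v)
    -- the twist partner's newform at level `M ℓ`, `ℓ` the Tamagawa prime, `ℓ ∤ M`
    {M : ℕ} [NeZero M] {ℓ : ℕ} [Fact ℓ.Prime] [NeZero (M * ℓ)] (hℓM : ¬ ℓ ∣ M) [NeZero d.natAbs]
    {f₀ : CuspForm (Gamma0 (M * ℓ)) 2} (hf₀ : IsNewformOf W₀ f₀)
    (hN₀ : M * ℓ ∣ N) (hm : d.natAbs ^ 2 ∣ N) (hmN : d.natAbs ∣ W.conductorNorm ℤ)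
    (hper₀ : ∃ u : ℚ, ‖(u : ℚ_[p])‖ = 1 ∧ W₀.realPeriodRat = u * plusPeriod f₀)
    (hirr₀ : W₀.HasIrreducibleModPGaloisRep p)
    (hℓN : ℓ ∣ W.conductorNorm ℤ) (hℓ : ℓ.Coprime d.natAbs)
    -- (MO) from print: eigencharacter, DDT Thm. 4.26 hypotheses + Galois package, repaired node, RIDER
    (χ₀ : HeckeRing0 (M * ℓ) 2 →+* k)
    (hχ₀ : ∀ (q : ℕ) (hq : q.Prime),
      χ₀ (HeckeRing0.T (M * ℓ) 2 q hq) = ι ((W₀.LFunction q : ℤ) : ZMod p))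
    (hp𝔪 : (p : HeckeRing0 (M * ℓ) 2) ∈ RingHom.ker χ₀) (h𝔪 : (RingHom.ker χ₀).IsMaximal)
    (hpN₀ : ¬ p ∣ M * ℓ ∨ (¬ p ^ 2 ∣ M * ℓ ∧ HeckeRing0.T (M * ℓ) 2 p hp5.out ∉ RingHom.ker χ₀))
    (k' : Type) [Field k'] [TopologicalSpace k'] [DiscreteTopology k']
    (ι' : HeckeRing0 (M * ℓ) 2 ⧸ RingHom.ker χ₀ →+* k') (ρ : ModPGaloisRep ℚ k' 2)
    (hρ : ∀ v : HeightOneSpectrum (𝓞 ℚ), ¬ ((primesEquiv v : Nat.Primes) : ℕ) ∣ M * ℓ * p →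
        ρ.IsUnramifiedAt v ∧
          ρ.HasFrobCharpolyAt v
            (X ^ 2
              - Polynomial.C (ι' (Ideal.Quotient.mk (RingHom.ker χ₀) (HeckeRing0.T (M * ℓ) 2
                  ((primesEquiv v : Nat.Primes) : ℕ) (primesEquiv v : Nat.Primes).2))) * X
              + Polynomial.C (((primesEquiv v : Nat.Primes) : ℕ) : k')))
    (hρirr : FramedRep.IsIrreducible ρ)
    (hES : EichlerShimuraModPMultiplicityOneOfIrreducible (M * ℓ) p χ₀
      (fun q ↦ ι ((W₀.LFunction q : ℤ) : ZMod p)))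
    (hrid : p ≠ 3 ∨ 9 ∣ M * ℓ ∨ ∃ q : ℕ, q.Prime ∧ q ∣ M * ℓ ∧ q % 3 = 2)
    -- (OLD) from print: the LEVEL-`M` eigen datum of Ribet's form + Ihara BY NAME + numerals
    {μ : ℚ → k} (hμ : IsPeriodic μ) (heven : ∀ r : ℚ, μ (-r) = μ r)
    (hΓ : potSymbOf μ ∈ (CoeffActionOn.symPowOn (sigma0Set M) 0 k).Symb (Gamma0 M))
    (θ : ℕ → k) (hT : ∀ q : ℕ, q.Prime → ¬ q ∣ M → HeckeRel μ q (θ q))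
    (hU : ∀ q : ℕ, q.Prime → q ∣ M → ∀ r : ℚ, ∑ j ∈ Finset.range q, μ ((r + j) / q) = θ q * μ r)
    (hθ : ∀ q : ℕ, q ≠ ℓ → ι ((W₀.LFunction q : ℤ) : ZMod p) = θ q)
    {w : k}
    (hα : ι ((W₀.LFunction ℓ : ℤ) : ZMod p) ^ 2 - θ ℓ * ι ((W₀.LFunction ℓ : ℤ) : ZMod p) + ℓ = 0)
    (hwα : w * ι ((W₀.LFunction ℓ : ℤ) : ZMod p) = 1)
    (Λ : Module.Dual ℂ (CuspForm (Gamma0 M) 2) → k)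
    (χ : HeckeRing0.primeTo M 2 (M * ℓ) →+* k)
    (hΛ : ∀ (s : HeckeRing0.primeTo M 2 (M * ℓ)), ∀ x ∈ periodHomology M,
      Λ ((s : HeckeRing0 M 2) • x) = χ s * Λ x)
    (h𝔫 : (RingHom.ker χ).IsMaximal) (hE : ¬ HeckeRing0.primeTo.IsEisenstein (RingHom.ker χ))
    {x : Module.Dual ℂ (CuspForm (Gamma0 M) 2)} (hx : x ∈ periodHomology M) (hΛx : Λ x ≠ 0)
    (hμΛ : ∀ y ∈ periodHomology M, ∀ r : ℚ,
      (∀ f : CuspForm (Gamma0 M) 2, y f = modularSymbol f r) → μ r = Λ y)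
    (hw : w * ι ((J((ℓ : ℤ) | d.natAbs) : ℤ) : ZMod p) = 1) : BSDp W p := by
  have hp2 : p ≠ 2 := by omega
  have h2 : (2 : k) ≠ 0 := by
    rw [show (2 : k) = ι 2 from (map_ofNat ι 2).symm, map_ne_zero ι,
      show (2 : ZMod p) = ((2 : ℕ) : ZMod p) by norm_cast, Ne, ZMod.natCast_eq_zero_iff]
    exact fun hd ↦ hp2 ((Nat.prime_dvd_prime_iff_eq hp5.out Nat.prime_two).mp hd)
  -- (MO) at level `Mℓ`: DDT Thm. 4.26 BY NAME + the repaired dictionary (rider displayed)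
  have hfin := (hW1 (M * ℓ) p hp2 (RingHom.ker χ₀) h𝔪 hp𝔪 k' ι' ρ hρ hρirr hpN₀).1
  have hMO : ModPMultiplicityOne k (M * ℓ) (fun q ↦ ι ((W₀.LFunction q : ℤ) : ZMod p)) :=
    hES hχ₀ hp𝔪 h𝔪 hfin k' ι' ρ hρ hρirr hrid
  -- (OLD) at level `Mℓ` from the level-`M` datum + Ihara's lemma BY NAME (K9 + K47)
  have hOLD : HasOldEigenPlusSymb k (M * ℓ) (fun q ↦ ι ((W₀.LFunction q : ℤ) : ZMod p)) ℓ w μ :=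
    hasOldEigenPlusSymb_of_ribet1984_iharaLemma hI hμ heven hΓ θ hT hU hℓM hα hwα
      (fun q ↦ ι ((W₀.LFunction q : ℤ) : ZMod p)) hθ rfl Λ χ hΛ h𝔫
      h2 hE hx hΛx hμΛ
  have hH : ∀ q : ℕ, Kato.IsKolyvaginPrime W p 1 q →
      HeckeRel μ q (ι ((W₀.LFunction q : ℤ) : ZMod p)) := fun q hq ↦
    heckeRel_of_isKolyvaginPrime_of_level W p hN hN₀ hℓN hT hθ hq
  -- gen 23's census-shape derivation, run into the `_kim2025_OPEN` consumers
  have hfW : IsNewformOf W D.f := D.isNewformOf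
  have hQ : coeffField f₀ = ⊥ := hf₀.coeffField_eq_bot
  have hΩ : plusPeriod f₀ ≠ 0 := (IsNewform0.exists_rat_smul_plusPeriod_holds hf₀.1 hQ).1
  have hint : ∀ x : ℚ, ¬ p ∣ (ratPlusSymbol f₀ x).den := fun x ↦
    not_dvd_den_of_norm_ratCast_le_one (Additive.norm_ratPlusSymbol_le_one_of_irreducible hp2 hf₀ hirr₀ x)
  have hadd := hasAdditiveReductionAt_quadraticTwist_of_good_or_mult W₀ hd4 hsq hgm
  obtain ⟨c₀, hc₀, hrel⟩ :=
    exists_rat_ratPlusSymbol_eq_twistSum_of_pos W₀ W hd4 hsq hd ⟨C, hC⟩ hadd hf₀ hfW hN₀ hm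
  have hθW : ∀ q : ℕ, Kato.IsKolyvaginPrime W p 1 q → ((W₀.LFunction q : ℤ) : ZMod p) =
      ((J((q : ℤ) | d.natAbs) : ℤ) : ZMod p) * (W.frobeniusTrace q : ZMod p) := fun q hq ↦
    lFunction_eq_jacobiSym_mul_frobeniusTrace_of_isKolyvaginPrime W₀ W p D hN hd4 hsq C hC hgm hmN hq
  by_cases hex : ∃ r : ℚ, ∑ u : ZMod d.natAbs, (J((u.val : ℤ) | d.natAbs) : ℚ) *
      ratPlusSymbol f₀ (r + (u.val : ℚ) / d.natAbs) ≠ 0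
  · obtain ⟨uW, huW, hΩW⟩ := hper
    obtain ⟨u₀, hu₀, hΩ₀⟩ := hper₀
    have hunit : ‖(c₀ : ℚ_[p])‖ = 1 :=
      norm_ratCast_eq_one_of_twist_of_pos p W₀ W hd4 hsq hd C hC hgm huW hu₀ hΩW hΩ₀ (hrel hex)
    exact bsdp_of_multiplicityOne_twist_of_tamagawa_le_two_of_shaAn_unit_of_kim2025_OPEN W p ι hK25s hCT
      hGZK hmod hp3 hr htower D hN ⟨uW, huW, hΩW⟩ hq' hv hc2 hmN hf₀.1 hQ hΩ hint
      (fun q ↦ W₀.LFunction q) (fun q _ ↦ (hf₀.2 q).symm) hθW c₀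
      (not_dvd_den_of_norm_ratCast_le_one hunit.le) hc₀ hMO hℓN hℓ hOLD hμ hH hw
  · -- every twisted sum vanishes: the plus symbol of `D.f` is identically `0`, trivial certificate
    simp only [not_exists, not_not] at hex
    have hcert : PlusSymbolLevelLowersOver W p D.f ι ℓ :=
      ⟨0, fun _ _ ↦ rfl, fun q _ r ↦ by simp, fun r ↦ by
        rw [hc₀ r, hex r, mul_zero, Rat.cast_zero, map_zero, Pi.zero_apply, Pi.zero_apply, sub_zero]⟩
    exact bsdp_of_plusSymbolLevelLowersOver_of_tamagawa_le_two_of_shaAn_unit_of_kim2025_OPEN W p hK25s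
      hCT hGZK hmod hp3 hr htower D hN hper hq' hv hcert hℓN hc2

/-- **TAM-DEFECT₂ ON THE TWIST-GOOD LOCUS, census shape, odd twists `d < 0`, `p ≥ 3` TOWER rows,
modulo the ANNOUNCED Kim 2025 clause — MULTIPLICITY ONE AND IHARA'S LEMMA BOTH BY NAME (minus
objects).** At `p = 3` (N11, the `E^{(−3)}`-type rows among them): rider displayed (`hrid`), imaginary
period transfer, minus-symbol integrality numeral, odd level-`M` datum. ⟹ **`BSD(E,p)`**. Nothing
booked. [claim: Kim2025RefinedTNC, status: under-review]
[cite: Kim2025RefinedTNC, Thm. 1.1 ("BSD") (ANNOUNCED, OPEN binder)]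
[cite: DarmonDiamondTaylor1995, Thm. 4.26 (§4.5, p. 134) and Lemma 4.28 (a) (p. 135)]
[cite: Ribet1984ICM, Thm. 4.1] [cite: Ribet1990, Thm. 1.1 and Thm. 5.2 (b)]
[cite: Pal2012, Thm. 3.2 with Prop. 2.5 and p. 1514 (Ω⁻)] [cite: SilvermanAEC2009, Thm. X.4.14] -/
theorem bsdp_of_wiles1995_ihara_quadraticTwist_of_neg_of_kim2025_OPEN
    (hW1 : wiles1995_multiplicityOne) (hI : ribet1984_iharaLemma)
    (hK25s : Kim2025.thm11_kimShaLength_of_integralPeriod_OPEN)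
    (hCT : exists_casselsTate_pairing (K := ℚ))
    (hGZK : rank_eq_analyticRank_of_analyticRank_le_one) (hmod : hasEntireLFunction_rat)
    (hp3 : 3 ≤ p) (hr : W.analyticRank = 0)
    (htower : ∀ n : ℕ, W.HasSurjectiveModNGaloisRep (p ^ n : ℕ))
    {N : ℕ} [NeZero N] (D : ModularParametrizationData W N) (hN : W.conductorNorm ℤ = N)
    (hper : ∃ u : ℚ, ‖(u : ℚ_[p])‖ = 1 ∧ W.realPeriodRat = u * plusPeriod D.f)
    {q' : ℚ} (hq' : shaAn W = (q' : ℂ)) (hv : padicValRat p q' = 0)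
    (hc2 : padicValNat p W.tamagawaProduct ≤ 2)
    {d : ℤ} (hd4 : d % 4 = 1) (hsq : Squarefree d) (hd : d < 0) (C : VariableChange ℚ)
    (hC : C • W₀.quadraticTwist (d : ℚ) = W)
    (hgm : ∀ v : HeightOneSpectrum (𝓞 ℚ), ((Rat.HeightOneSpectrum.primesEquiv v : ℕ) : ℤ) ∣ d →
      W₀.HasGoodReductionAt v ∨ W₀.HasMultiplicativeReductionAt v)
    {M : ℕ} [NeZero M] {ℓ : ℕ} [Fact ℓ.Prime] [NeZero (M * ℓ)] (hℓM : ¬ ℓ ∣ M) [NeZero d.natAbs]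
    {f₀ : CuspForm (Gamma0 (M * ℓ)) 2} (hf₀ : IsNewformOf W₀ f₀)
    (hN₀ : M * ℓ ∣ N) (hm : d.natAbs ^ 2 ∣ N) (hmN : d.natAbs ∣ W.conductorNorm ℤ)
    (hper₀ : ∃ u : ℚ, ‖(u : ℚ_[p])‖ = 1 ∧ W₀.imaginaryPeriodRat = u * minusPeriod f₀)
    (hint : ∀ x : ℚ, ¬ p ∣ (ratMinusSymbol f₀ x).den)
    (hℓN : ℓ ∣ W.conductorNorm ℤ) (hℓ : ℓ.Coprime d.natAbs)
    -- (MO⁻) from print, rider displayed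
    (χ₀ : HeckeRing0 (M * ℓ) 2 →+* k)
    (hχ₀ : ∀ (q : ℕ) (hq : q.Prime),
      χ₀ (HeckeRing0.T (M * ℓ) 2 q hq) = ι ((W₀.LFunction q : ℤ) : ZMod p))
    (hp𝔪 : (p : HeckeRing0 (M * ℓ) 2) ∈ RingHom.ker χ₀) (h𝔪 : (RingHom.ker χ₀).IsMaximal)
    (hpN₀ : ¬ p ∣ M * ℓ ∨ (¬ p ^ 2 ∣ M * ℓ ∧ HeckeRing0.T (M * ℓ) 2 p hp5.out ∉ RingHom.ker χ₀))
    (k' : Type) [Field k'] [TopologicalSpace k'] [DiscreteTopology k']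
    (ι' : HeckeRing0 (M * ℓ) 2 ⧸ RingHom.ker χ₀ →+* k') (ρ : ModPGaloisRep ℚ k' 2)
    (hρ : ∀ v : HeightOneSpectrum (𝓞 ℚ), ¬ ((primesEquiv v : Nat.Primes) : ℕ) ∣ M * ℓ * p →
        ρ.IsUnramifiedAt v ∧
          ρ.HasFrobCharpolyAt v
            (X ^ 2
              - Polynomial.C (ι' (Ideal.Quotient.mk (RingHom.ker χ₀) (HeckeRing0.T (M * ℓ) 2
                  ((primesEquiv v : Nat.Primes) : ℕ) (primesEquiv v : Nat.Primes).2))) * X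
              + Polynomial.C (((primesEquiv v : Nat.Primes) : ℕ) : k')))
    (hρirr : FramedRep.IsIrreducible ρ)
    (hES : EichlerShimuraModPMultiplicityOneMinusOfIrreducible (M * ℓ) p χ₀
      (fun q ↦ ι ((W₀.LFunction q : ℤ) : ZMod p)))
    (hrid : p ≠ 3 ∨ 9 ∣ M * ℓ ∨ ∃ q : ℕ, q.Prime ∧ q ∣ M * ℓ ∧ q % 3 = 2)
    -- (OLD⁻) from print: the odd LEVEL-`M` eigen datum + Ihara BY NAME + numerals
    {μ : ℚ → k} (hμ : IsPeriodic μ) (hodd : ∀ r : ℚ, μ (-r) = -μ r)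
    (hΓ : potSymbOf μ ∈ (CoeffActionOn.symPowOn (sigma0Set M) 0 k).Symb (Gamma0 M))
    (θ : ℕ → k) (hT : ∀ q : ℕ, q.Prime → ¬ q ∣ M → HeckeRel μ q (θ q))
    (hU : ∀ q : ℕ, q.Prime → q ∣ M → ∀ r : ℚ, ∑ j ∈ Finset.range q, μ ((r + j) / q) = θ q * μ r)
    (hθ : ∀ q : ℕ, q ≠ ℓ → ι ((W₀.LFunction q : ℤ) : ZMod p) = θ q)
    {w : k}
    (hα : ι ((W₀.LFunction ℓ : ℤ) : ZMod p) ^ 2 - θ ℓ * ι ((W₀.LFunction ℓ : ℤ) : ZMod p) + ℓ = 0)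
    (hwα : w * ι ((W₀.LFunction ℓ : ℤ) : ZMod p) = 1)
    (Λ : Module.Dual ℂ (CuspForm (Gamma0 M) 2) → k)
    (χ : HeckeRing0.primeTo M 2 (M * ℓ) →+* k)
    (hΛ : ∀ (s : HeckeRing0.primeTo M 2 (M * ℓ)), ∀ x ∈ periodHomology M,
      Λ ((s : HeckeRing0 M 2) • x) = χ s * Λ x)
    (h𝔫 : (RingHom.ker χ).IsMaximal) (hE : ¬ HeckeRing0.primeTo.IsEisenstein (RingHom.ker χ))
    {x : Module.Dual ℂ (CuspForm (Gamma0 M) 2)} (hx : x ∈ periodHomology M) (hΛx : Λ x ≠ 0)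
    (hμΛ : ∀ y ∈ periodHomology M, ∀ r : ℚ,
      (∀ f : CuspForm (Gamma0 M) 2, y f = modularSymbol f r) → μ r = Λ y)
    (hw : w * ι ((J((ℓ : ℤ) | d.natAbs) : ℤ) : ZMod p) = 1) : BSDp W p := by
  have hp2 : p ≠ 2 := by omega
  have h2 : (2 : k) ≠ 0 := by
    rw [show (2 : k) = ι 2 from (map_ofNat ι 2).symm, map_ne_zero ι,
      show (2 : ZMod p) = ((2 : ℕ) : ZMod p) by norm_cast, Ne, ZMod.natCast_eq_zero_iff]
    exact fun hd ↦ hp2 ((Nat.prime_dvd_prime_iff_eq hp5.out Nat.prime_two).mp hd)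
  have hfin := (hW1 (M * ℓ) p hp2 (RingHom.ker χ₀) h𝔪 hp𝔪 k' ι' ρ hρ hρirr hpN₀).1
  have hMO : ModPMultiplicityOneMinus k (M * ℓ) (fun q ↦ ι ((W₀.LFunction q : ℤ) : ZMod p)) :=
    hES hχ₀ hp𝔪 h𝔪 hfin k' ι' ρ hρ hρirr hrid
  have hOLD : HasOldEigenMinusSymb k (M * ℓ) (fun q ↦ ι ((W₀.LFunction q : ℤ) : ZMod p)) ℓ w μ :=
    hasOldEigenMinusSymb_of_ribet1984_iharaLemma hI hμ hodd hΓ θ hT hU hℓM hα hwα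
      (fun q ↦ ι ((W₀.LFunction q : ℤ) : ZMod p)) hθ rfl Λ χ hΛ h𝔫
      h2 hE hx hΛx hμΛ
  have hH : ∀ q : ℕ, Kato.IsKolyvaginPrime W p 1 q →
      HeckeRel μ q (ι ((W₀.LFunction q : ℤ) : ZMod p)) := fun q hq ↦
    heckeRel_of_isKolyvaginPrime_of_level W p hN hN₀ hℓN hT hθ hq
  have hfW : IsNewformOf W D.f := D.isNewformOf
  have hQ : coeffField f₀ = ⊥ := hf₀.coeffField_eq_bot
  have hΩ : minusPeriod f₀ ≠ 0 := (IsNewform0.exists_rat_smul_minusPeriod_holds hf₀.1 hQ).1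
  have hadd := hasAdditiveReductionAt_quadraticTwist_of_good_or_mult W₀ hd4 hsq hgm
  obtain ⟨c₀, hc₀, hrel⟩ :=
    exists_rat_ratPlusSymbol_eq_twistSum_of_neg W₀ W hd4 hsq hd ⟨C, hC⟩ hadd hf₀ hfW hN₀ hm
  have hθW : ∀ q : ℕ, Kato.IsKolyvaginPrime W p 1 q → ((W₀.LFunction q : ℤ) : ZMod p) =
      ((J((q : ℤ) | d.natAbs) : ℤ) : ZMod p) * (W.frobeniusTrace q : ZMod p) := fun q hq ↦
    lFunction_eq_jacobiSym_mul_frobeniusTrace_of_isKolyvaginPrime W₀ W p D hN hd4 hsq C hC hgm hmN hq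
  by_cases hex : ∃ r : ℚ, ∑ u : ZMod d.natAbs, (J((u.val : ℤ) | d.natAbs) : ℚ) *
      ratMinusSymbol f₀ (r + (u.val : ℚ) / d.natAbs) ≠ 0
  · obtain ⟨uW, huW, hΩW⟩ := hper
    obtain ⟨u₀, hu₀, hΩ₀⟩ := hper₀
    have hunit : ‖(c₀ : ℚ_[p])‖ = 1 :=
      norm_ratCast_eq_one_of_twist_of_neg p W₀ W hp2 hd4 hsq hd C hC hgm huW hu₀ hΩW hΩ₀ (hrel hex)
    exact bsdp_of_multiplicityOneMinus_twist_of_tamagawa_le_two_of_shaAn_unit_of_kim2025_OPEN W p ι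
      hK25s hCT hGZK hmod hp3 hr htower D hN ⟨uW, huW, hΩW⟩ hq' hv hc2 hmN hf₀.1 hQ hΩ hint
      (fun q ↦ W₀.LFunction q) (fun q _ ↦ (hf₀.2 q).symm) hθW c₀
      (not_dvd_den_of_norm_ratCast_le_one hunit.le) hc₀ hMO hℓN hℓ hOLD hμ hH hw
  · simp only [not_exists, not_not] at hex
    have hcert : PlusSymbolLevelLowersOver W p D.f ι ℓ :=
      ⟨0, fun _ _ ↦ rfl, fun q _ r ↦ by simp, fun r ↦ by
        rw [hc₀ r, hex r, mul_zero, Rat.cast_zero, map_zero, Pi.zero_apply, Pi.zero_apply, sub_zero]⟩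
    exact bsdp_of_plusSymbolLevelLowersOver_of_tamagawa_le_two_of_shaAn_unit_of_kim2025_OPEN W p hK25s
      hCT hGZK hmod hp3 hr htower D hN hper hq' hv hcert hℓN hc2

end Summit.BirchSwinnertonDyer.Rank1Residual.X4

end
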